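import Summits.HubbardSuperconductivity.HubbardSuperconductivity.Theorems.JosephsonMirrorJmPairBridgeSchurBridge
import Summits.HubbardSuperconductivity.HubbardSuperconductivity.Theorems.JosephsonMirrorJmPairBridgeEveryFromSomeTorus
import Summits.HubbardSuperconductivity.HubbardSuperconductivity.Theses.JosephsonMirror
import HarnessLib

/-!
# Crux `JmPairBridge` (stmt-HubbardSuperconductivity-2226), line `Sketch` (Schur landing):
# the sorry-free Schur glue `JmInterchange → (gain ∧ eventual irreducible floor) → JmPairBridge`

Route `JosephsonMirror`, crux `JmPairBridge` (thesis X: the every-ground-state pair bridge between the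
`(N_L, 0)` and `(N_L - 2, 0)` ground floors of `hubbardTorus 2 L 1 U`). This file COMPOSES the three landed
stubs of the Schur landing of line `Sketch` (it re-proves the ten-line pure-logic glue instead of importing
`…SchurGlue`, to stay independent of that module):

* `everyFromSome_torus` — `stub_everyFromSome_torus` fed with `stub_schurBridge`: on the Hubbard torus, if
  the `(N, 0)` ground floor is irreducible under a family of unitaries commuting with `H`, preserving the
  sectors `(N, 0)`, `(N - 2, 0)` and twisting `Δ_d` by unimodular phases, then ONE bridged unit pair of sector
  ground states (`t ≤ |⟨χ₀, Δ_d φ₀⟩|²`) makes EVERY unit ground state of `(N, 0)` bridged with the same `t`;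
* `jmPairBridge_of_interchange_of_irreducible` — the glue of `Theorems/JosephsonMirrorJmPairBridgeSchurGlue`
  (`stub_schurGlue`, `jmPairBridge_of_interchange`) with its transfer hypothesis DISCHARGED by it: the route's
  crux `JmInterchange` (stmt-2227) together with the gain data of `JmCusp (i)` and EVENTUAL IRREDUCIBILITY of
  the `(N_L, 0)` floor at the same `(U, δ)` proves the crux `JmPairBridge` BY NAME — the route glue
  `JmCruxGlue` with `JmCusp (ii)` (eventual simplicity, generically false on open-shell sides) replaced by
  irreducibility (symmetry-enforced floor multiplets allowed; only accidental degeneracy excluded).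

(The space-group form — eventual irreducibility of the `(N_L, 0)` floor under the SPACE GROUP `{U_γ U_v}` of the
torus, via `exists_symmetryFamily_of_spaceGroup_irreducible` of `Theorems/JosephsonMirrorJmPairBridgeSpaceGroupFamily` —
is filed separately as `Theorems/JosephsonMirrorJmPairBridgeSchurCuspSpaceGroup.lean`.)

What remains of the crux after this file is exactly its second hypothesis at some `(U, δ)`: the conclusion
of `JmInterchange ∘ JmCusp (i)` (some bridged pair, eventually) and the irreducible floor — the residue
`stub_someBridgeIrreducibleWitness` of the lead skeleton `Cruxes/JmPairBridge/Lines/Sketch.lean`.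

Sources: J.-P. Serre, *Linear Representations of Finite Groups* §2.2 (Schur); T. Koma, H. Tasaki,
J. Stat. Phys. 76 (1994) 745, §3.4 (pair matrix elements between towers); H. Tasaki, *Physics and
Mathematics of Quantum Many-Body Systems* (2020) §2.1. No definition, no named fact.
-/

noncomputable section

-- the mandated namespace `Summit.<Summit>.<Problem>.Theorems` repeats `HubbardSuperconductivity`
-- (single-problem summit, D-0017), which the `dupNamespace` linter flags on every declaration
set_option linter.dupNamespace false

namespace Summit.HubbardSuperconductivity.HubbardSuperconductivity.Theorems.JosephsonMirror

open Matrix Literature.MathematicalPhysics.QuantumLattice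
open Summit.HubbardSuperconductivity.HubbardSuperconductivity.Theses.JosephsonMirror
  (JmPairBridge JmInterchange)
open scoped ComplexOrder

/-- **Every-from-some on the torus** (stubs `stub_schurBridge` + `stub_everyFromSome_torus` composed): for
`H = hubbardTorus 2 L 1 U`, a family `S` of unitaries commuting with `H`, preserving the sectors `(N, 0)` and
`(N - 2, 0)` and twisting `Δ_d` by unimodular phases, an `S`-irreducible `(N, 0)` ground floor and ONE pair of
unit sector ground states `φ₀ ∈ (N, 0)`, `χ₀ ∈ (N - 2, 0)` with `t ≤ |⟨χ₀, Δ_d φ₀⟩|²`, EVERY unit ground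
state `φ` of `(N, 0)` has a unit ground state `χ` of `(N - 2, 0)` with `t ≤ |⟨χ, Δ_d φ⟩|²`.
Serre §2.2; Tasaki (2020) §2.1. [folklore] -/
theorem everyFromSome_torus (L : ℕ) [NeZero L] (U : ℝ) (N : ℕ) (t : ℝ)
    (S : Set (Matrix (Finset (Orb (FermionTorus 2 L))) (Finset (Orb (FermionTorus 2 L))) ℂ))
    (hS : ∀ X ∈ S, Xᴴ * X = 1 ∧ X * hubbardTorus 2 L 1 U = hubbardTorus 2 L 1 U * X ∧
      (∀ v ∈ szSector N 0, X *ᵥ v ∈ szSector N 0) ∧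
      (∀ v ∈ szSector (N - 2) 0,
        X *ᵥ v ∈ szSector (N - 2) 0) ∧
      ∃ ω : ℂ, ‖ω‖ = 1 ∧ X * pairField dWaveFormFactor L = ω • (pairField dWaveFormFactor L * X))
    (hirr : ∀ K' : Submodule ℂ (Fock (Orb (FermionTorus 2 L))),
      K' ≤ szSector N 0 ⊓
          Module.End.eigenspace (Matrix.toLin' (hubbardTorus 2 L 1 U))
            (((hubbardTorus 2 L 1 U).minEnergyOn (szSector N 0) : ℝ) : ℂ) →
      (∀ X ∈ S, ∀ v ∈ K', X *ᵥ v ∈ K') →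
      K' = ⊥ ∨ K' = szSector N 0 ⊓
          Module.End.eigenspace (Matrix.toLin' (hubbardTorus 2 L 1 U))
            (((hubbardTorus 2 L 1 U).minEnergyOn (szSector N 0) : ℝ) : ℂ))
    (hsome : ∃ φ₀ χ₀ : Fock (Orb (FermionTorus 2 L)),
      IsGroundStateInSector (hubbardTorus 2 L 1 U) N 0 φ₀ ∧ star φ₀ ⬝ᵥ φ₀ = 1 ∧
      IsGroundStateInSector (hubbardTorus 2 L 1 U) (N - 2) 0 χ₀ ∧ star χ₀ ⬝ᵥ χ₀ = 1 ∧
      t ≤ ‖star χ₀ ⬝ᵥ Matrix.mulVec (pairField dWaveFormFactor L) φ₀‖ ^ 2) :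
    ∀ φ : Fock (Orb (FermionTorus 2 L)), IsGroundStateInSector (hubbardTorus 2 L 1 U) N 0 φ →
      star φ ⬝ᵥ φ = 1 →
      ∃ χ : Fock (Orb (FermionTorus 2 L)), IsGroundStateInSector (hubbardTorus 2 L 1 U) (N - 2) 0 χ ∧
        star χ ⬝ᵥ χ = 1 ∧ t ≤ ‖star χ ⬝ᵥ Matrix.mulVec (pairField dWaveFormFactor L) φ‖ ^ 2 :=
  stub_everyFromSome_torus
    (fun _ _ _ Δ F Fm S' hSU hSF hSF' hSFm hSFm' hSΔ hirr' t' hsome' =>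
      stub_schurBridge Δ F Fm S' hSU hSF hSF' hSFm hSFm' hSΔ hirr' t' hsome')
    L U N t S hS hirr hsome


/-- **The Schur glue of route `JosephsonMirror`** (sorry-free; `JmCruxGlue` with simplicity replaced by
irreducibility): crux `JmInterchange` (stmt-2227), the uniform linear Josephson gain of `JmCusp (i)` at some
`(U, δ, a, J₀)` and eventual irreducibility of the `(N_L, 0)` ground floor at the same `(U, δ)` under some
family of pair-field-twisting unitary symmetries of `hubbardTorus 2 L 1 U` prove the crux `JmPairBridge`.
Koma–Tasaki, J. Stat. Phys. 76 (1994) 745, §3.4; Serre §2.2. [folklore] -/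
theorem jmPairBridge_of_interchange_of_irreducible (hI : JmInterchange)
    (hC :
    (∃ U : ℝ, 0 < U ∧ ∃ δ ∈ Set.Ioo (0:ℝ) (1 / 2), ∃ a : ℝ, 0 < a ∧ ∃ J₀ : ℝ, 0 < J₀ ∧
      (∀ J ∈ Set.Ioc (0:ℝ) J₀, ∃ L₀ : ℕ, ∀ (L : ℕ) [NeZero L], Even L → L₀ ≤ L →
        (let ι : Type := Finset (Orb (FermionTorus 2 L))
         let N : ℕ := 2 * ⌊(1 - δ) * (L : ℝ) ^ 2 / 2⌋₊
         let H : Matrix ι ι ℂ := hubbardTorus 2 L 1 U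
         let μ : ℝ := (H.minEnergyOn (szSector N 0) - H.minEnergyOn (szSector (N - 2) 0)) / 2
         let A : Matrix ι ι ℂ := hubbardTorusWith 2 L 1 U μ
         let D : Matrix ι ι ℂ := ((L : ℂ))⁻¹ • pairField dWaveFormFactor L
         let Hd : ℝ → Matrix (ι × ι) (ι × ι) ℂ := fun J =>
           Matrix.kroneckerMap (fun a b : ℂ => a * b) A 1 +
             Matrix.kroneckerMap (fun a b : ℂ => a * b) 1 (Matrix.transpose A) -
             (J : ℂ) • (Matrix.kroneckerMap (fun a b : ℂ => a * b) D
                 (Matrix.transpose (Matrix.conjTranspose D)) +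
               Matrix.kroneckerMap (fun a b : ℂ => a * b) (Matrix.conjTranspose D) (Matrix.transpose D))
         let good : ι × ι → Prop := fun p =>
           ((p.1.card = N ∧ p.2.card = N) ∨ (p.1.card = N - 2 ∧ p.2.card = N - 2)) ∧
             (p.1.filter (fun o => (ofLex o).2 = 0)).card = (p.1.filter (fun o => (ofLex o).2 = 1)).card ∧
             (p.2.filter (fun o => (ofLex o).2 = 0)).card = (p.2.filter (fun o => (ofLex o).2 = 1)).card
         let S : Submodule ℂ (ι × ι → ℂ) :=
           ⨅ (p : ι × ι) (_ : ¬ good p), LinearMap.ker (LinearMap.proj (R := ℂ) (φ := fun _ : ι × ι => ℂ) p)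
         let E : ℝ → ℝ := fun J => (Hd J).minEnergyOn S
         a * J * (L : ℝ) ^ 2 ≤ E 0 - E J)) ∧
      (∃ L₁ : ℕ, ∀ (L : ℕ) [NeZero L], Even L → L₁ ≤ L →
        ∃ S : Set (Matrix (Finset (Orb (FermionTorus 2 L))) (Finset (Orb (FermionTorus 2 L))) ℂ),
          (∀ X ∈ S, Xᴴ * X = 1 ∧ X * hubbardTorus 2 L 1 U = hubbardTorus 2 L 1 U * X ∧
            (∀ v ∈ szSector (2 * ⌊(1 - δ) * (L : ℝ) ^ 2 / 2⌋₊) 0,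
              X *ᵥ v ∈ szSector (2 * ⌊(1 - δ) * (L : ℝ) ^ 2 / 2⌋₊) 0) ∧
            (∀ v ∈ szSector (2 * ⌊(1 - δ) * (L : ℝ) ^ 2 / 2⌋₊ - 2) 0,
              X *ᵥ v ∈ szSector (2 * ⌊(1 - δ) * (L : ℝ) ^ 2 / 2⌋₊ - 2) 0) ∧
            ∃ ω : ℂ, ‖ω‖ = 1 ∧
              X * pairField dWaveFormFactor L = ω • (pairField dWaveFormFactor L * X)) ∧
          ∀ K' : Submodule ℂ (Fock (Orb (FermionTorus 2 L))),
            K' ≤ szSector (2 * ⌊(1 - δ) * (L : ℝ) ^ 2 / 2⌋₊) 0 ⊓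
                Module.End.eigenspace (Matrix.toLin' (hubbardTorus 2 L 1 U))
                  (((hubbardTorus 2 L 1 U).minEnergyOn
                    (szSector (2 * ⌊(1 - δ) * (L : ℝ) ^ 2 / 2⌋₊) 0) : ℝ) : ℂ) →
            (∀ X ∈ S, ∀ v ∈ K', X *ᵥ v ∈ K') →
            K' = ⊥ ∨ K' = szSector (2 * ⌊(1 - δ) * (L : ℝ) ^ 2 / 2⌋₊) 0 ⊓
                Module.End.eigenspace (Matrix.toLin' (hubbardTorus 2 L 1 U))
                  (((hubbardTorus 2 L 1 U).minEnergyOn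
                    (szSector (2 * ⌊(1 - δ) * (L : ℝ) ^ 2 / 2⌋₊) 0) : ℝ) : ℂ)))) :
    JmPairBridge := by
  -- the pure-logic glue (same proof as the landed `stub_schurGlue` / `jmPairBridge_of_interchange`, inlined)
  unfold JmPairBridge
  obtain ⟨U, hU, δ, hδ, a, ha, J₀, hJ₀, hgain, L₁, hirrL⟩ := hC
  obtain ⟨a', ha', L₀, hbridge⟩ := hI U δ a J₀ hU hδ ha hJ₀ hgain
  refine ⟨U, hU, δ, hδ, a', ha', max L₀ L₁, fun L _ hE hL φ hφ hφ1 => ?_⟩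
  obtain ⟨φ₀, χ₀, hφ₀, hφ₀1, hχ₀, hχ₀1, hle⟩ := hbridge L hE (le_of_max_le_left hL)
  obtain ⟨S, hS, hirr⟩ := hirrL L hE (le_of_max_le_right hL)
  exact everyFromSome_torus L U _ _ S hS hirr ⟨φ₀, χ₀, hφ₀, hφ₀1, hχ₀, hχ₀1, hle⟩ φ hφ hφ1

end Summit.HubbardSuperconductivity.HubbardSuperconductivity.Theorems.JosephsonMirror

end
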